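import Literature.Computability.AlgebraicComplexity.KIReductionBricksFinal
import Literature.Computability.QuantumComplexity.BosonReductionCodes
import HarnessLib

/-!
# Kabanets–Impagliazzo, Cor. 12: the reduction machine, VI — input validity and the reduction `kiRed`

Tenth file of the discharge of the reduction fact
`Literature.Computability.AlgebraicComplexity.permanent01Graph_polyExists_preimage_PIT`
(`PermanentGraphNSUBEXP.lean`). The graph language `permanent01Graph` contains CANONICAL code
words `⟨⟨M⟩, bin v⟩` only, so the reduction must reject every other first component. It does so by
re-encoding: `CXF w₀` writes the canonical code of the parsed data (`nOf`, `parsedM`, `vOf`), and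
the input is valid iff it equals this re-encoding (`validF`, an `eqPairFn` test). Then

  `kiRed = iteFn validF wordF (const badWord)`,

with **`kiRed_mem_FP`**, **`kiRed_apply`** / **`kiRed_canonical`** (on `⟨x, y⟩` with `x` the
canonical code of a `0/1` matrix `M` and a value `v`, `kiRed ⟨x, y⟩` is the identity-test word of
`kiCircuit n M v (readBlocks y)`) and **`kiRed_of_ne`** (otherwise `badWord`); `parse_canonical` and
`canonX_canonical` say that parsing a canonical code returns its data.

## References

* V. Kabanets, R. Impagliazzo, *Derandomizing polynomial identity tests means proving circuit
  lower bounds*, STOC 2003, §2.1 (p. 357: the language `{(M, v) | …}`), proof of Cor. 12 (p. 358).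
* S. Arora, B. Barak, *Computational Complexity: A Modern Approach*, CUP 2009, §0.1, §1.3.
-/

noncomputable section

namespace Literature.Computability.AlgebraicComplexity

namespace KIReduction

open _root_.Computability Complexity Brick OracleCompose HashBricks Plumb Polynomial ArithCircuit QuantumComplexity

/-! ### The canonical re-encoding -/

/-- `OracleCompose.body = encList` (both are the iterated pairing; private copy of a lemma held outside this file's import
cone: `CodeFPArith.lean`, `GoldwasserSipserRefereeBricks.lean`, `AKSMachineFP.lean`). [folklore] -/
private theorem body_eq_encList (l : List (List Bool)) : body l = encList l := by
  induction l with
  | nil => rfl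
  | cons a l ih => rw [body_cons, encList_cons, ih]

/-- The entry frame on a column record `⟨⟨⟨U, rows⟩, 1ᵃ⟩, 1ᵇ⟩`: `⟨intCode (parsedEntry rows a b), ε⟩`. [folklore] -/
def entryFrameF : List Bool → List Bool := frameF (List.tail ∘ List.tail ∘ constOpF)

/-- `entryFrameF ∈ FP`. [folklore] -/
theorem entryFrameF_mem_FP : entryFrameF ∈ FP :=
  frameF_mem_FP (comp_mem_FP PRelSigma.tail_mem_FP (comp_mem_FP PRelSigma.tail_mem_FP constOpF_mem_FP))

/-- Value of the entry frame. [folklore] -/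
theorem entryFrameF_rec (U rows : List Bool) (a b : ℕ) :
    entryFrameF (boolPair (boolPair (boolPair U rows) (ones a)) (ones b)) = boolPair (intCode (parsedEntry rows a b)) [] := by
  rw [entryFrameF, frameF_apply]; simp [constOpF_rec]

/-- Length of the entry frame: at most `12`. [folklore] -/
theorem length_entryFrameF_le (U rows : List Bool) (a b : ℕ) :
    (entryFrameF (boolPair (boolPair (boolPair U rows) (ones a)) (ones b))).length ≤ 12 := by
  rw [entryFrameF_rec, length_boolPair, parsedEntry]
  split_ifs <;> simp [intCode_one, intCode_zero]

/-- The row frame on `⟨⟨U, rows⟩, 1ᵃ⟩`: `⟨⟨1ⁿ, encList (entry codes of row a)⟩, ε⟩`. [folklore] -/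
def rowReF : List Bool → List Bool :=
  frameF (fanoutFn (onesFn ∘ fstF ∘ fstF) (foldCat 12 X entryFrameF ∘ fanoutFn id (fstF ∘ fstF)))

/-- `rowReF ∈ FP`. [folklore] -/
theorem rowReF_mem_FP : rowReF ∈ FP :=
  frameF_mem_FP (fanoutFn_mem_FP (comp_mem_FP onesFn_mem_FP (comp_mem_FP fstF_mem_FP fstF_mem_FP))
    (comp_mem_FP (foldCat_mem_FP _ _ entryFrameF_mem_FP) (fanoutFn_mem_FP id_mem_FP (comp_mem_FP fstF_mem_FP fstF_mem_FP))))

/-- `onesFn w = 1^{|w|}` (private copy of a lemma held outside this file's import cone: `OneInThreeSATMachine.lean`,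
`ThreeDMMachine.lean`, `MetaComplexity/UPSearchMachines.lean`). [folklore] -/
private theorem onesFn_eq_ones (w : List Bool) : onesFn w = ones w.length := by
  rw [onesFn, OracleCompose.unaryEncodeNat_eq_replicate]

/-- Value of the row frame. [folklore] -/
theorem rowReF_rec (U rows : List Bool) (a : ℕ) :
    rowReF (boolPair (boolPair U rows) (ones a)) =
      boolPair (boolPair (ones U.length) (encList ((List.range U.length).map fun b => intCode (parsedEntry rows a b)))) [] := by
  rw [rowReF, frameF_apply]
  simp only [fanoutFn_apply, Function.comp_apply, fstF_boolPair, id, onesFn_eq_ones]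
  rw [foldCat_apply (p := X) (by simp only [Polynomial.eval_X, length_boolPair, length_ones']; omega)
      (fun b _ => (length_entryFrameF_le U rows a b).trans (by simp)),
    ccat_congr (fun b _ => entryFrameF_rec U rows a b), ccat_frame_eq_encList]

/-- Length of the row frame: `≤ 28 |U| + 8`. [folklore] -/
theorem length_rowReF_le (U rows : List Bool) (a : ℕ) : (rowReF (boolPair (boolPair U rows) (ones a))).length ≤ 28 * U.length + 8 := by
  rw [rowReF_rec, length_boolPair, length_boolPair, length_ones', List.length_nil]
  have h : ∀ x ∈ (List.range U.length).map (fun b => intCode (parsedEntry rows a b)), x.length ≤ 5 := by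
    intro x hx
    rw [List.mem_map] at hx
    obtain ⟨b, -, rfl⟩ := hx
    rw [parsedEntry]; split_ifs <;> simp [intCode_one, intCode_zero]
  have := length_encList_le h
  rw [List.length_map, List.length_range] at this
  omega

/-- The rows re-encoding on `⟨U, rows⟩`: `encList` of the canonical rows of the parsed matrix. [folklore] -/
def rowsReF : List Bool → List Bool := foldCat (28 * X + 8) X rowReF ∘ fanoutFn id fstF

/-- `rowsReF ∈ FP`. [folklore] -/
theorem rowsReF_mem_FP : rowsReF ∈ FP := comp_mem_FP (foldCat_mem_FP _ _ rowReF_mem_FP) (fanoutFn_mem_FP id_mem_FP fstF_mem_FP)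

/-- Value of the rows re-encoding. [folklore] -/
theorem rowsReF_apply (U rows : List Bool) :
    rowsReF (boolPair U rows) = encList ((List.range U.length).map fun a =>
      boolPair (ones U.length) (encList ((List.range U.length).map fun b => intCode (parsedEntry rows a b)))) := by
  rw [rowsReF, Function.comp_apply, fanoutFn_apply, id, fstF_boolPair,
    foldCat_apply (p := X) (by simp only [Polynomial.eval_X, length_boolPair]; omega)
      (fun a _ => (length_rowReF_le U rows a).trans (by
        simp only [Polynomial.eval_add, Polynomial.eval_mul, Polynomial.eval_ofNat, Polynomial.eval_X, length_boolPair]; omega)),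
    ccat_congr (fun a _ => rowReF_rec U rows a), ccat_frame_eq_encList]

/-- **The canonical re-encoding brick**: `⟨⟨bin n, ⟨1ⁿ, rows of the parsed matrix⟩⟩, bin v⟩`. [cite: KabanetsImpagliazzo2003, §2.1 (p. 357)] -/
def CXF : List Bool → List Bool :=
  fanoutFn (fanoutFn (lenBinF ∘ uF) (fanoutFn (onesFn ∘ uF) (rowsReF ∘ fanoutFn uF rowsF))) (addFn ∘ fanoutFn vcF (fun _ => []))

/-- `CXF ∈ FP`. [folklore] -/
theorem CXF_mem_FP : CXF ∈ FP :=
  fanoutFn_mem_FP (fanoutFn_mem_FP (comp_mem_FP lenBinF_mem_FP uF_mem_FP) (fanoutFn_mem_FP (comp_mem_FP onesFn_mem_FP uF_mem_FP)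
    (comp_mem_FP rowsReF_mem_FP (fanoutFn_mem_FP uF_mem_FP rowsF_mem_FP)))) (comp_mem_FP addFn_mem_FP (fanoutFn_mem_FP vcF_mem_FP (const_mem_FP _)))

/-- **The canonical code of the parsed data.** [cite: KabanetsImpagliazzo2003, §2.1 (p. 357)] -/
def canonX (w₀ : List Bool) : List Bool :=
  boolPair (encodingIntMatrix.encode ⟨nOf w₀, parsedM w₀⟩) (encodeNat (vOf w₀))

/-- **Value of the re-encoding brick**: the canonical code of the parsed data. [folklore] -/
theorem CXF_apply (w₀ : List Bool) : CXF w₀ = canonX w₀ := by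
  rw [canonX, BosonCodes.encode_matrix_eq, CXF]
  simp only [fanoutFn_apply, Function.comp_apply, uF_apply, rowsF_apply, vcF_apply, lenBinF_apply, onesFn_eq_ones, rowsReF_apply,
    addFn_boolPair, bitsToNat_nil, add_zero, body_eq_encList, nOf, vOf]
  congr 3
  refine congr_arg encList (map_ofFn_eq_map_range _ _ fun a => ?_).symm
  congr 1
  rw [← body_eq_encList, body_eq_encList]
  exact congr_arg encList (map_ofFn_eq_map_range _ _ fun b => rfl).symm

/-! ### Validity -/

/-- The parsed matrix has entries `0/1`. [folklore] -/
theorem parsedM_zero_one (w₀ : List Bool) (a b : Fin (nOf w₀)) : parsedM w₀ a b = 0 ∨ parsedM w₀ a b = 1 := by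
  unfold parsedM parsedEntry; split_ifs <;> simp

/-- The items of `encList` by iterated projections (private copy of a lemma held outside this file's import cone:
`MaxCutNP.lean`, `MaxCutGadgetMachine.lean`, `FineGrained/SerfSNPProofs.lean`). [folklore] -/
private theorem fstF_iterate_sndF_encList (L : List (List Bool)) (i : ℕ) : fstF (sndF^[i] (encList L)) = L.getD i [] := by
  rw [← getD_readList, readList_encList]

/-- **Parsing a canonical code returns its data**: for `w₀ = ⟨⟨⟨M⟩, bin v⟩, y⟩` with `M` a `0/1`
matrix, `nOf w₀ = n`, `vOf w₀ = v`, and the parsed entries are those of `M`. [folklore] -/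
theorem parse_canonical {m : ℕ} (M : Fin m → Fin m → ℤ) (hM : ∀ a b, M a b = 0 ∨ M a b = 1) (v : ℕ) (y : List Bool) :
    nOf (boolPair (boolPair (encodingIntMatrix.encode ⟨m, M⟩) (encodeNat v)) y) = m ∧
    vOf (boolPair (boolPair (encodingIntMatrix.encode ⟨m, M⟩) (encodeNat v)) y) = v ∧
    ∀ (a b : ℕ) (ha : a < m) (hb : b < m),
      parsedEntry (rowsStr (boolPair (boolPair (encodingIntMatrix.encode ⟨m, M⟩) (encodeNat v)) y)) a b = M ⟨a, ha⟩ ⟨b, hb⟩ := by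
  simp only [nOf, uStr, vOf, vcStr, rowsStr, BosonCodes.encode_matrix_eq, fstF_boolPair, sndF_boolPair, length_ones',
    bitsToNat_encodeNat, body_eq_encList, true_and]
  intro a b ha hb
  simp only [parsedEntry, entryStr, fstF_iterate_sndF_encList, List.getD_eq_getElem?_getD, List.getElem?_ofFn, ha,
    dif_pos, Option.getD_some, sndF_boolPair, hb]
  have hinj : ∀ z : ℤ, BosonCodes.intCode z = intCode 1 ↔ z = 1 := fun z =>
    ⟨fun h => encodingIntBool.encode_injective h, fun h => by subst h; rfl⟩
  simp only [hinj]
  rcases hM ⟨a, ha⟩ ⟨b, hb⟩ with h | h <;> simp [h]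

/-- Transport of a matrix along an equality of dimensions, as an equality of dependent pairs. [folklore] -/
theorem sigma_eq_of_cast {m k : ℕ} (hk : k = m) (M : Fin m → Fin m → ℤ) (M' : Fin k → Fin k → ℤ)
    (h : ∀ a b, M' a b = M (Fin.cast hk a) (Fin.cast hk b)) : (⟨k, M'⟩ : Σ n : ℕ, Fin n → Fin n → ℤ) = ⟨m, M⟩ := by
  subst hk
  have : M' = M := funext fun a => funext fun b => by simpa using h a b
  rw [this]

/-- **A canonical input equals its re-encoding.** [folklore] -/
theorem canonX_canonical {m : ℕ} (M : Fin m → Fin m → ℤ) (hM : ∀ a b, M a b = 0 ∨ M a b = 1) (v : ℕ) (y : List Bool) :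
    canonX (boolPair (boolPair (encodingIntMatrix.encode ⟨m, M⟩) (encodeNat v)) y) =
      boolPair (encodingIntMatrix.encode ⟨m, M⟩) (encodeNat v) := by
  obtain ⟨hn, hv, hE⟩ := parse_canonical M hM v y
  rw [canonX, hv, sigma_eq_of_cast hn M (parsedM _) (fun a b => ?_)]
  rw [parsedM, hE a.val b.val (by omega) (by omega)]
  rfl

/-- `readBlocks` of the guess is `blocksOf`. [folklore] -/
theorem blocksOf_boolPair (x y : List Bool) : blocksOf (boolPair x y) = readBlocks y := by
  simp [blocksOf, yStr]

/-! ### The reduction -/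

/-- **The validity test**: `[fstF w₀ = canonical re-encoding]`. [cite: KabanetsImpagliazzo2003, §2.1 (p. 357)] -/
def validF : List Bool → List Bool := eqPairFn ∘ fanoutFn fstF CXF

/-- `validF ∈ FP`. [folklore] -/
theorem validF_mem_FP : validF ∈ FP := comp_mem_FP eqPairFn_mem_FP (fanoutFn_mem_FP fstF_mem_FP CXF_mem_FP)

/-- Value of the validity test. [folklore] -/
theorem validF_apply (w₀ : List Bool) : validF w₀ = [decide (fstF w₀ = canonX w₀)] := by
  simp [validF, eqPairFn_boolPair, CXF_apply]

/-- **The Kabanets–Impagliazzo reduction** `kiRed`: on a valid input the identity-test word of the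
instance, otherwise the rejected word. [cite: KabanetsImpagliazzo2003, Lemma 11 and proof of Cor. 12 (p. 358)] -/
def kiRed : List Bool → List Bool := iteFn validF wordF (fun _ => badWord)

/-- **`kiRed ∈ FP`.** [cite: AroraBarakCC2009, §1.3] -/
theorem kiRed_mem_FP : kiRed ∈ FP := iteFn_mem_FP validF_mem_FP wordF_mem_FP (const_mem_FP _)

/-- **Value of the reduction.** [folklore] -/
theorem kiRed_apply (w₀ : List Bool) :
    kiRed w₀ = if fstF w₀ = canonX w₀ then circuitWord (nOf w₀ * nOf w₀) (kiCircuit (nOf w₀) (parsedM w₀) (vOf w₀) (blocksOf w₀))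
      else badWord := by
  rw [kiRed, iteFn_apply (validF_apply w₀), ← wordF_apply]
  by_cases h : fstF w₀ = canonX w₀ <;> simp [h]

/-- **The reduction on a canonical input**: the identity-test word of the instance on `(M, v)` and
the guess read off `y`. [cite: KabanetsImpagliazzo2003, proof of Cor. 12 (p. 358)] -/
theorem kiRed_canonical {m : ℕ} (M : Fin m → Fin m → ℤ) (hM : ∀ a b, M a b = 0 ∨ M a b = 1) (v : ℕ) (y : List Bool) :
    ∃ (M' : Fin (nOf (boolPair (boolPair (encodingIntMatrix.encode ⟨m, M⟩) (encodeNat v)) y)) →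
        Fin (nOf (boolPair (boolPair (encodingIntMatrix.encode ⟨m, M⟩) (encodeNat v)) y)) → ℤ)
      (hm : nOf (boolPair (boolPair (encodingIntMatrix.encode ⟨m, M⟩) (encodeNat v)) y) = m),
      (∀ a b, M' a b = M (Fin.cast hm a) (Fin.cast hm b)) ∧
      kiRed (boolPair (boolPair (encodingIntMatrix.encode ⟨m, M⟩) (encodeNat v)) y) =
        circuitWord (nOf (boolPair (boolPair (encodingIntMatrix.encode ⟨m, M⟩) (encodeNat v)) y) *
          nOf (boolPair (boolPair (encodingIntMatrix.encode ⟨m, M⟩) (encodeNat v)) y))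
          (kiCircuit _ M' v (readBlocks y)) := by
  obtain ⟨hn, hv, hE⟩ := parse_canonical M hM v y
  refine ⟨parsedM _, hn, fun a b => ?_, ?_⟩
  · rw [parsedM, hE a.val b.val (by omega) (by omega)]; rfl
  · rw [kiRed_apply, if_pos, hv, blocksOf_boolPair]
    rw [fstF_boolPair, canonX_canonical M hM v y]

/-- **The reduction on an invalid input** is the rejected word. [folklore] -/
theorem kiRed_of_ne {w₀ : List Bool} (h : fstF w₀ ≠ canonX w₀) : kiRed w₀ = badWord := by
  rw [kiRed_apply, if_neg h]

end KIReduction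

end Literature.Computability.AlgebraicComplexity

end
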